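import Mathlib

/-!
# The determinant of a rank-one perturbation, and adjugates of matrices with zero row/column sums

General commutative-ring linear algebra used by the forest-formula proofs of Smith 2016, Thm. 2.2
(files `Literature/NumberTheory/EllipticCurves/Smith2016/CongruentNumberGenusDeterminant*`):

* `det_add_vecMulVec` — **Cauchy's formula for a rank-one perturbation** (the general "matrix
  determinant lemma", [HornJohnson2013, §0.8.5]): `det (A + u vᵀ) = det A + vᵀ adj(A) u` for EVERY
  square `A` over a commutative ring (Mathlib's `Matrix.det_add_replicateCol_mul_replicateRow` assumes
  `det A` is a unit; the general form is its stated TODO).  Proof: multilinearity in the columns —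
  two columns proportional to `u` kill all terms of order `≥ 2` (`det_of_add_ite_mem`).
* `det_eq_zero_of_mulVec_one`, `adjugate_apply_eq_of_mulVec_one`, `adjugate_apply_eq_of_one_vecMul`,
  `adjugate_apply_eq_adjugate_apply` — for a matrix whose rows sum to zero (`M·1 = 0`) all cofactors
  along a row agree and `det M = 0`; if also the columns sum to zero, ALL cofactors are equal
  ([HornJohnson2013, §0.8.2]: `adj A` of a matrix of rank `≤ n − 1` has rank `≤ 1` and its columns /
  rows lie in the kernels), whence `vᵀ adj(M) u = (Σ v)(Σ u) · adj(M)_{aa}` and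
  `det (M + u vᵀ) = (Σ u)(Σ v) · adj(M)_{aa}` (`det_add_vecMulVec_of_mulVec_one`).
* `det_updateCol_eq_sum_mul_adjugate` — replacing a column of a zero-column-sum matrix by `w` gives
  `(Σ w) ·` (the diagonal cofactor).
* Over `𝔽₂`: a symmetric matrix defines the LINEAR form `x ↦ xᵀ S x = Σ_a S_aa x_a`
  (`dotProduct_mulVec_eq_sum_diag`), so `det (S + u uᵀ) = det S + Σ_a u_a adj(S)_{aa}`
  (`det_add_vecMulVec_self`).
-/

namespace Literature.LinearAlgebra.Matrix

open _root_.Matrix Finset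

variable {n : Type*} [Fintype n] [DecidableEq n]

section CommRing

variable {R : Type*} [CommRing R]

/-- Multilinear expansion of `det` in the columns `j ∈ T` perturbed by `v j · u`: all terms with two
perturbed columns vanish (two columns proportional to `u`), so
`det (A + (u vᵀ restricted to the columns T)) = det A + Σ_{j ∈ T} v j · det (A with column j := u)`.
[cite: HornJohnson2013, §0.8.5 (Cauchy's formula for the determinant of a rank-one perturbation)] -/
theorem det_of_add_ite_mem (u v : n → R) (T : Finset n) :
    ∀ A : Matrix n n R, (Matrix.of fun i j => A i j + if j ∈ T then u i * v j else 0).det =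
      A.det + ∑ j ∈ T, v j * (A.updateCol j u).det := by
  induction T using Finset.induction_on with
  | empty =>
    intro A
    rw [sum_empty, add_zero]
    congr 1
    ext i j
    simp
  | insert j₀ T hj₀ ih =>
    intro A
    -- the matrix for `insert j₀ T` is the matrix for `T` with column `j₀` further perturbed
    have hcol : (Matrix.of fun i j => A i j + if j ∈ insert j₀ T then u i * v j else 0) =
        (Matrix.of fun i j => A i j + if j ∈ T then u i * v j else 0).updateCol j₀
          ((fun i => A i j₀) + v j₀ • u) := by
      ext i j
      rw [updateCol_apply]
      by_cases hj : j = j₀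
      · subst hj
        simp only [Matrix.of_apply, mem_insert, true_or, if_true, Pi.add_apply, Pi.smul_apply,
          smul_eq_mul]
        ring
      · rw [if_neg hj]
        simp only [Matrix.of_apply, mem_insert, hj, false_or]
    have hself : (Matrix.of fun i j => A i j + if j ∈ T then u i * v j else 0).updateCol j₀
        (fun i => A i j₀) = Matrix.of fun i j => A i j + if j ∈ T then u i * v j else 0 := by
      ext i j
      rw [updateCol_apply]
      by_cases hj : j = j₀
      · subst hj; simp only [Matrix.of_apply, if_neg hj₀, add_zero, if_true]
      · rw [if_neg hj]
    -- the `u`-column version: apply the induction hypothesis to `A` with column `j₀ := u`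
    have hu : (Matrix.of fun i j => A i j + if j ∈ T then u i * v j else 0).updateCol j₀ u =
        Matrix.of fun i j => (A.updateCol j₀ u) i j + if j ∈ T then u i * v j else 0 := by
      ext i j
      rw [updateCol_apply, Matrix.of_apply, Matrix.of_apply, updateCol_apply]
      by_cases hj : j = j₀
      · subst hj; rw [if_pos rfl, if_pos rfl, if_neg hj₀, add_zero]
      · rw [if_neg hj, if_neg hj]
    have hvan : ∀ j ∈ T, ((A.updateCol j₀ u).updateCol j u).det = 0 := by
      intro j hj
      have hne : j ≠ j₀ := fun h => hj₀ (h ▸ hj)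
      refine det_zero_of_column_eq hne (fun i => ?_)
      rw [updateCol_self, updateCol_ne hne.symm, updateCol_self]
    have hzero : ∑ j ∈ T, v j * ((A.updateCol j₀ u).updateCol j u).det = 0 :=
      sum_eq_zero fun j hj => by rw [hvan j hj, mul_zero]
    rw [hcol, det_updateCol_add, hself, det_updateCol_smul, hu, ih, ih (A.updateCol j₀ u), hzero,
      add_zero, sum_insert hj₀]
    ring

/-- **Cauchy's formula / the matrix determinant lemma in adjugate form**: for every square matrix `A`
over a commutative ring and vectors `u, v`, `det (A + u vᵀ) = det A + vᵀ · adj(A) · u`.  (No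
invertibility hypothesis; compare Mathlib's `Matrix.det_add_replicateCol_mul_replicateRow`.)
[cite: HornJohnson2013, §0.8.5 (Cauchy's formula for the determinant of a rank-one perturbation)] -/
theorem det_add_vecMulVec (A : Matrix n n R) (u v : n → R) :
    (A + vecMulVec u v).det = A.det + v ⬝ᵥ (A.adjugate *ᵥ u) := by
  have h := det_of_add_ite_mem u v univ A
  have hA : (Matrix.of fun i j => A i j + if j ∈ (univ : Finset n) then u i * v j else 0) =
      A + vecMulVec u v := by
    ext i j; simp [vecMulVec_apply]
  rw [hA] at h
  rw [h, ← cramer_eq_adjugate_mulVec, dotProduct]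
  exact congrArg _ (sum_congr rfl fun j _ => by rw [cramer_apply])

/-- Replacing a column: `det (A with column c := w) = Σᵢ adj(A)_{c i} wᵢ` (Cramer / cofactor expansion).
[cite: HornJohnson2013, §0.8.2 (adjugate and cofactor expansion)] -/
theorem det_updateCol_eq_adjugate_mulVec (A : Matrix n n R) (c : n) (w : n → R) :
    (A.updateCol c w).det = (A.adjugate *ᵥ w) c := by
  rw [← cramer_eq_adjugate_mulVec, cramer_apply]

/-- **Rows summing to zero force `det = 0`** (nonempty index type): `M·1 = 0 ⟹ det M · 1 = adj(M) M 1 = 0`.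
[cite: HornJohnson2013, §0.8.2 (adj(A) A = det(A) I)] -/
theorem det_eq_zero_of_mulVec_one [Nonempty n] (M : Matrix n n R) (h : M *ᵥ (fun _ => (1 : R)) = 0) :
    M.det = 0 := by
  have h2 : M.adjugate *ᵥ (M *ᵥ fun _ => (1 : R)) = fun _ => M.det := by
    rw [mulVec_mulVec, adjugate_mul, smul_mulVec, one_mulVec]
    ext i; simp
  rw [h, mulVec_zero] at h2
  have := congrFun h2 (Classical.arbitrary n)
  simpa using this.symm

/-- **All cofactors along a row agree when the rows sum to zero**: if `M·1 = 0` then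
`adj(M)_{i j} = adj(M)_{i' j}` for all `i, i'` (the cofactors of the entries of row `j`); indeed their
difference is the determinant of `M` with row `j` replaced by `eᵢ − eᵢ'`, a matrix still killing `1`.
[cite: HornJohnson2013, §0.8.2 (columns of adj A lie in the null space when A is singular)] -/
theorem adjugate_apply_eq_of_mulVec_one [Nonempty n] (M : Matrix n n R)
    (h : M *ᵥ (fun _ => (1 : R)) = 0) (i i' j : n) : M.adjugate i j = M.adjugate i' j := by
  by_cases hii' : i = i'
  · rw [hii']
  rw [adjugate_apply, adjugate_apply]
  have hsplit : (Pi.single i (1 : R) : n → R) = Pi.single i' 1 + (Pi.single i 1 - Pi.single i' 1) := by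
    abel
  rw [hsplit, det_updateRow_add]
  suffices h0 : (M.updateRow j (Pi.single i (1 : R) - Pi.single i' 1)).det = 0 by rw [h0, add_zero]
  refine det_eq_zero_of_mulVec_one _ ?_
  ext a
  rw [Pi.zero_apply, mulVec]
  change (M.updateRow j (Pi.single i (1 : R) - Pi.single i' 1)) a ⬝ᵥ (fun _ => (1 : R)) = 0
  by_cases ha : a = j
  · subst ha
    rw [updateRow_self, sub_dotProduct, dotProduct, dotProduct, Fintype.sum_eq_single i,
      Fintype.sum_eq_single i']
    · simp
    · intro b hb; simp [hb]
    · intro b hb; simp [hb]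
  · rw [updateRow_ne ha]
    have := congrFun h a
    rwa [mulVec, Pi.zero_apply] at this

/-- **All cofactors along a column agree when the columns sum to zero**: if `1ᵀ·M = 0` then
`adj(M)_{i j} = adj(M)_{i j'}` (transpose of the previous statement). [cite: HornJohnson2013, §0.8.2] -/
theorem adjugate_apply_eq_of_one_vecMul [Nonempty n] (M : Matrix n n R)
    (h : (fun _ => (1 : R)) ᵥ* M = 0) (i j j' : n) : M.adjugate i j = M.adjugate i j' := by
  have hT : Mᵀ *ᵥ (fun _ => (1 : R)) = 0 := by rw [mulVec_transpose]; exact h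
  have := adjugate_apply_eq_of_mulVec_one Mᵀ hT j j' i
  rwa [← adjugate_transpose, transpose_apply, transpose_apply] at this

/-- **All cofactors of a matrix with zero row sums AND zero column sums are equal.**
[cite: HornJohnson2013, §0.8.2 (adj A has rank ≤ 1 when rank A ≤ n − 1, with rows and columns in the null spaces)] -/
theorem adjugate_apply_eq_adjugate_apply [Nonempty n] (M : Matrix n n R)
    (hr : M *ᵥ (fun _ => (1 : R)) = 0) (hc : (fun _ => (1 : R)) ᵥ* M = 0) (i j i' j' : n) :
    M.adjugate i j = M.adjugate i' j' := by
  rw [adjugate_apply_eq_of_mulVec_one M hr i i' j, adjugate_apply_eq_of_one_vecMul M hc i' j j']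

/-- For a matrix with zero row and column sums, the bilinear form of the adjugate factors:
`vᵀ adj(M) u = (Σ v)(Σ u) · adj(M)_{a a}` for any fixed index `a`. [cite: HornJohnson2013, §0.8.2] -/
theorem dotProduct_adjugate_mulVec_of_mulVec_one [Nonempty n] (M : Matrix n n R)
    (hr : M *ᵥ (fun _ => (1 : R)) = 0) (hc : (fun _ => (1 : R)) ᵥ* M = 0) (u v : n → R) (a : n) :
    v ⬝ᵥ (M.adjugate *ᵥ u) = (∑ i, v i) * (∑ j, u j) * M.adjugate a a := by
  simp only [dotProduct, mulVec]
  rw [sum_mul, sum_mul]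
  refine sum_congr rfl fun i _ => ?_
  rw [mul_sum, mul_sum, sum_mul]
  refine sum_congr rfl fun j _ => ?_
  rw [adjugate_apply_eq_adjugate_apply M hr hc i j a a]
  ring

/-- **Rank-one perturbation of a matrix with zero row and column sums**:
`det (M + u vᵀ) = (Σ u)(Σ v) · adj(M)_{a a}` (its own determinant vanishes).
[cite: HornJohnson2013, §0.8.5 with §0.8.2] -/
theorem det_add_vecMulVec_of_mulVec_one [Nonempty n] (M : Matrix n n R)
    (hr : M *ᵥ (fun _ => (1 : R)) = 0) (hc : (fun _ => (1 : R)) ᵥ* M = 0) (u v : n → R) (a : n) :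
    (M + vecMulVec u v).det = (∑ j, u j) * (∑ i, v i) * M.adjugate a a := by
  rw [det_add_vecMulVec, det_eq_zero_of_mulVec_one M hr, zero_add,
    dotProduct_adjugate_mulVec_of_mulVec_one M hr hc u v a]
  ring

/-- **Replacing a column of a zero-column-sum matrix**: if `1ᵀ·M = 0` then
`det (M with column c := w) = (Σ w) · adj(M)_{c c}` (all cofactors along the column agree).
[cite: HornJohnson2013, §0.8.2] -/
theorem det_updateCol_eq_sum_mul_adjugate [Nonempty n] (M : Matrix n n R)
    (hc : (fun _ => (1 : R)) ᵥ* M = 0) (c : n) (w : n → R) :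
    (M.updateCol c w).det = (∑ i, w i) * M.adjugate c c := by
  rw [det_updateCol_eq_adjugate_mulVec, mulVec, dotProduct, sum_mul]
  exact sum_congr rfl fun i _ => by rw [adjugate_apply_eq_of_one_vecMul M hc c i c, mul_comm]

/-- The diagonal cofactor is the determinant with the column replaced by a unit vector:
`adj(M)_{c c} = det (M with column c := e_c)`. [cite: HornJohnson2013, §0.8.2] -/
theorem adjugate_apply_self_eq_det_updateCol (M : Matrix n n R) (c : n) :
    M.adjugate c c = (M.updateCol c (Pi.single c 1)).det := by
  rw [det_updateCol_eq_adjugate_mulVec, mulVec, dotProduct, Fintype.sum_eq_single c]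
  · simp
  · intro b hb; simp [hb]

end CommRing

section ZModTwo

/-- **Over `𝔽₂` a symmetric matrix defines a LINEAR form on the diagonal**: `xᵀ S x = Σ_a S_aa x_a`
(the off-diagonal terms cancel in pairs, and `x_a² = x_a`).
[cite: HornJohnson2013, §4.1 (quadratic form of a symmetric matrix), read in characteristic 2] -/
theorem dotProduct_mulVec_eq_sum_diag {S : Matrix n n (ZMod 2)} (hS : Sᵀ = S) (x : n → ZMod 2) :
    x ⬝ᵥ (S *ᵥ x) = ∑ a, S a a * x a := by
  simp only [dotProduct, mulVec]
  have hsq : ∀ c : ZMod 2, c * c = c := by decide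
  -- split each inner sum into the diagonal term and the rest
  have hsplit : ∀ a, x a * ∑ b, S a b * x b = S a a * x a + ∑ b ∈ univ.erase a, x a * (S a b * x b) := by
    intro a
    rw [mul_sum, ← add_sum_erase _ _ (mem_univ a)]
    congr 1
    rw [← mul_assoc, mul_comm (x a) (S a a), mul_assoc, hsq]
  rw [sum_congr rfl fun a _ => hsplit a, sum_add_distrib]
  suffices h0 : ∑ a, ∑ b ∈ univ.erase a, x a * (S a b * x b) = 0 by rw [h0, add_zero]
  -- the off-diagonal double sum is symmetric under `(a, b) ↦ (b, a)` and `2 = 0`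
  have hoff : ∑ a, ∑ b ∈ univ.erase a, x a * (S a b * x b) =
      ∑ ab ∈ (univ : Finset n) ×ˢ (univ : Finset n),
        (if ab.1 = ab.2 then (0 : ZMod 2) else x ab.1 * (S ab.1 ab.2 * x ab.2)) := by
    rw [sum_product]
    refine sum_congr rfl fun a _ => ?_
    rw [← add_sum_erase _ _ (mem_univ a), if_pos rfl, zero_add]
    exact sum_congr rfl fun b hb => (if_neg (ne_of_mem_erase hb).symm).symm
  rw [hoff]
  have h2 : ∀ c : ZMod 2, c + c = 0 := by decide
  refine sum_involution (fun ab _ => (ab.2, ab.1)) ?_ ?_ ?_ ?_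
  · rintro ⟨a, b⟩ _
    by_cases hab : a = b
    · subst hab; simp
    · have hba : b ≠ a := Ne.symm hab
      have hSab : S b a = S a b := by rw [← hS, transpose_apply, hS]
      simp only [if_neg hab, if_neg hba, hSab]
      calc x a * (S a b * x b) + x b * (S a b * x a)
          = x a * (S a b * x b) + x a * (S a b * x b) := by ring
        _ = 0 := h2 _
  · rintro ⟨a, b⟩ _ h
    by_cases hab : a = b
    · subst hab; simp at h
    · simp only [ne_eq, Prod.mk.injEq, not_and]
      exact fun h' => absurd h'.symm hab
  · rintro ⟨a, b⟩ _; simp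
  · rintro ⟨a, b⟩ _; rfl

/-- **Symmetric rank-one update over `𝔽₂`**: for symmetric `S`,
`det (S + u uᵀ) = det S + Σ_a u_a · adj(S)_{a a}` (only diagonal cofactors survive).
[cite: HornJohnson2013, §0.8.5 with §0.8.2 (adjugate of a symmetric matrix is symmetric)] -/
theorem det_add_vecMulVec_self {S : Matrix n n (ZMod 2)} (hS : Sᵀ = S) (u : n → ZMod 2) :
    (S + vecMulVec u u).det = S.det + ∑ a, u a * S.adjugate a a := by
  have hadj : (S.adjugate)ᵀ = S.adjugate := by rw [adjugate_transpose, hS]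
  rw [det_add_vecMulVec, dotProduct_mulVec_eq_sum_diag hadj]
  exact congrArg _ (sum_congr rfl fun a _ => mul_comm _ _)

end ZModTwo

end Literature.LinearAlgebra.Matrix
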